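import Summits.QuantumFields.YangMills.Theorems.UnitScaleTiltHalvingP1FlatCoreTopCubeGeometry
import Summits.QuantumFields.YangMills.Theorems.UnitScaleTiltHalvingP1FlatCoreCubeInclusion
import Summits.QuantumFields.YangMills.Theorems.UnitScaleTiltProp7AxialGaugeFace
import Summits.QuantumFields.YangMills.Theorems.AlphaInputsT3ACv3RelativeGaugeDrift
import Literature.MathematicalPhysics.QuantumFieldTheory.Balaban1983to89.B8Ineq129
import HarnessLib

/-!
# Route `UnitScaleTilt`, crux K1 child «MinimiserStabilityRegPr» (stmt-QuantumFields-19200), registered stub `stub_halvingStep` (H) — pillar P1♭ `core′`,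
# LEAD-H junction **J1c PART 2 «WALKS IN THE TOP CUBE»** (LEAD-H 11:45:48Z «wanted»): for `y` in the top cube `□_k` every step of the comb walk
# `walk y₀ (treeWord (rel y₀ y))` and of the contour walk `walk y₀ (contourT y₀ c)` (`c₋, c₊ ∈ □_k`) has both bond ends in `□_k` — the `h`-binder
# territory of ✓`P1FlatCoreDP1Target.norm_axialT_sub_one_le` ∕ `norm_mlog_axialT_le` (the (o) LEFT-side datum, controlled only on top-cube bonds)

Cell `ym3-torus` ∕ `pub/ym-inputs`, seat `ym-inputs-p09`.  `--supports stmt-QuantumFields-19200 --as helper`; THEOREMS ONLY (0 `def`, 0 `sorry`); count-neutral; nothing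
here claims the stub, the crux, d = 4 or the mass gap — YM₃ on T³ is a ladder rung (R3), not the Clay problem.

THE POINT.  The top cube `□_k = cubeFinM x₀ k ρ S M k` is the `M`-SATURATED sup-ball of radius `ρ` about `y₀ = Bᵏx₀`: a site belongs iff some site with the same
big-block labels `val∕M` lies in the ball.  Because the labels are read coordinatewise and the blocks `{v | v.val∕M = q}` are INTERVALS of the cyclic coordinate, the
cube is coordinatewise BETWEEN-CLOSED in the relative coordinates `rel y₀` as long as nothing wraps (`2·(ρ + M) ≤ sitesPerDir k`): if `y ∈ □_k` and `z ∈ ℤᵈ` lies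
coordinatewise between `0` and `rel y₀ y`, then `y₀ + z ∈ □_k` (★`transl_mem_cubeFinM_top_of_between`, from the one-coordinate label lemma ★`val_div_eq_of_between`).
The comb `Γ_{y₀,y}` never leaves the lattice box spanned by its end points (✓`B8Ineq129.disp_prefix_treeWord_mem`), so all its prefix positions — hence all its bond
ends (✓`NewtonLiftFramed.walk_bond_mem_of_prefix_mem` of `AlphaInputsT3ACv3RelativeGaugeDrift`) — lie in `□_k`; the same for the reversed comb from `y` and, gluing the three legs of
✓`contourT_eq`, for the contour of a top bond with both ends in `□_k` (the no-wrap identity ✓`rel_shift_of_le` is paid by the same premise).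

WHAT IS PROVED (def-free): §1 `val_add_natCast_eq`, ★`val_div_eq_of_between`, `natAbs_valMinAbs_intCast_le'`; §2 ★`transl_mem_cubeFinM_top_of_between`;
§3 `walkEnd_eq_transl_disp`, `walkEnd_take_treeWord_mem_top`, ★★`walk_treeWord_subset_top`, `walkEnd_take_revWord_treeWord_mem_top`, ★`walk_revWord_treeWord_subset_top`,
★★`walk_contourT_subset_top`; §4 the member forms at `(cubeSeqMT3 F n K x ρ S M hM).Om (K − n)` under the room premise `ρ + M ≤ L^{m+n}` (`n < K`):
`two_mul_add_le_sitesPerDir_top_of_room`, ★★`walk_treeWord_subset_Om_top`, ★★`walk_contourT_subset_Om_top`.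
HONEST SCOPE: geometry bookkeeping on the route's top cube; nothing here proves `core′`, the stub or the crux.

References: T. Bałaban, CMP **98** (1985) 17–51 [Balaban1985Averaging] ((8) p.19, pp.24–25 «Γ_{y,x}»); CMP **102** (1985) 277–309 [Balaban1985Variational] ((144) p.300);
CMP **95** (1984) 17–40 [Balaban1984PropagatorsI] ((1.7) p.18).
-/

set_option autoImplicit false

namespace Summit.QuantumFields.YangMills.Theorems.P1FlatCoreTopCubeWalks

open Literature.MathematicalPhysics.QuantumFieldTheory.Balaban1983to89
open Literature.MathematicalPhysics.QuantumFieldTheory.Balaban1983to89.T3ContinuumYM3Torus (T3Family)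
open B5Eq117TorusCarriers (Mk)
open B5Eq118OneStroke (iterBlockOf)
open B5Prop12FieldsLattice (distSite)
open B7Prop1Explicit (e e_apply treeWord revWord disp disp_treeWord disp_append disp_revWord)
open B7Prop1Explicit renaming Site → LSite
open B10Eq27TorusAxialLog (rel rel_apply transl transl_apply transl_add transl_rel transl_disp_treeWord_rel contourT contourT_eq rel_shift_of_le)
open B8Ineq129 (disp_prefix_treeWord_mem)
open FlatCubeSequenceAligned (cubeSeqMT3 cubeSeqM_Om_pos cubeFinM radM mem_cubeFinM_iff)
open P1FlatCoreTopCubeGeometry (natAbs_rel_le_of_mem_top)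
open P1FlatCoreCubeInclusion (natAbs_valMinAbs_le_of_distSite_le)
open Summit.QuantumFields.YangMills.Theorems.Prop7AxialGaugeFace (disp_apply_eq_netDisp walkEnd_treeWord_rel)
open T4Continuum (walk walkEnd walkEnd_apply LStep walk_append walkEnd_append)
open Summit.QuantumFields.YangMills.Theorems.NewtonLiftFramed (walk_bond_mem_of_prefix_mem)

/-! ## §1 One cyclic coordinate: big-block labels are intervals -/

section Coord

variable {N : ℕ} [NeZero N]

/-- `(a + δ).val = (a.val + δ) mod N` for a natural shift `δ`. [folklore] -/
theorem val_add_natCast_eq (a : ZMod N) (δ : ℕ) : (a + (δ : ZMod N)).val = (a.val + δ) % N := by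
  rw [ZMod.val_add, ZMod.val_natCast, Nat.add_mod_mod]

/-- ★ **BIG-BLOCK LABELS ARE INTERVALS (no wrap)**: if the sites `c + u` and `c + w` (`u ≤ w`, `w − u + M ≤ N`) of the cyclic group `ℤ/N` carry the same
big-block label `val∕M` (`1 ≤ M`), then so does every `c + t`, `u ≤ t ≤ w`. The wrap is excluded by counting: two `val`s with the same label differ by `< M`,
a wrapped pair by `≥ N − (w − u) ≥ M`. [cite: Balaban1984PropagatorsII, (2.1) p.224 («a sum of big blocks»), bookkeeping] -/
theorem val_div_eq_of_between {M : ℕ} (hM : 1 ≤ M) (c : ZMod N) {u t w : ℤ} (hut : u ≤ t) (htw : t ≤ w) (hgap : w - u + M ≤ N)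
    (hlab : (c + (u : ZMod N)).val / M = (c + (w : ZMod N)).val / M) :
    (c + (t : ZMod N)).val / M = (c + (w : ZMod N)).val / M := by
  obtain ⟨δ, hδ⟩ : ∃ δ : ℕ, w = u + δ := ⟨(w - u).toNat, by omega⟩
  obtain ⟨τ, hτ⟩ : ∃ τ : ℕ, t = u + τ := ⟨(t - u).toNat, by omega⟩
  have hτδ : τ ≤ δ := by omega
  have hδN : δ + M ≤ N := by omega
  have hw : c + (w : ZMod N) = (c + (u : ZMod N)) + (δ : ZMod N) := by rw [hδ]; push_cast; ring
  have ht : c + (t : ZMod N) = (c + (u : ZMod N)) + (τ : ZMod N) := by rw [hτ]; push_cast; ring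
  rw [hw, val_add_natCast_eq] at hlab
  rw [hw, ht, val_add_natCast_eq, val_add_natCast_eq]
  have haN : (c + (u : ZMod N)).val < N := ZMod.val_lt _
  generalize (c + (u : ZMod N)).val = a at hlab haN ⊢
  by_cases hwrap : a + δ < N
  · rw [Nat.mod_eq_of_lt hwrap] at hlab ⊢
    rw [Nat.mod_eq_of_lt (by omega : a + τ < N)]
    apply le_antisymm
    · exact Nat.div_le_div_right (by omega)
    · rw [← hlab]; exact Nat.div_le_div_right (by omega)
  · exfalso
    push Not at hwrap
    have hb : (a + δ) % N = a + δ - N := by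
      rw [Nat.mod_eq_sub_mod hwrap, Nat.mod_eq_of_lt (by omega)]
    rw [hb] at hlab
    have h1 : a < a / M * M + M := Nat.lt_div_mul_add (by omega)
    have h2 : (a + δ - N) / M * M ≤ a + δ - N := Nat.div_mul_le_self _ _
    rw [hlab] at h1
    generalize (a + δ - N) / M * M = X at h1 h2
    omega

/-- the least residue of an integer is no larger than the integer. [folklore] -/
theorem natAbs_valMinAbs_intCast_le' (z : ℤ) : (((z : ZMod N)).valMinAbs).natAbs ≤ z.natAbs :=
  ZMod.natAbs_min_of_le_div_two N _ z (ZMod.coe_valMinAbs _) (ZMod.natAbs_valMinAbs_le _)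

end Coord

/-! ## §2 The top cube is coordinatewise between-closed in the relative coordinates `rel y₀` -/

section Between

variable {P : Params} {x₀ : Site P 0} {k ρ S M : ℕ}

/-- ★ **THE TOP CUBE IS BETWEEN-CLOSED** (`1 ≤ M`, no wrap `2·(ρ + M) ≤ sitesPerDir k`): if `y ∈ □_k = cubeFinM x₀ k ρ S M k` and `z ∈ ℤᵈ` lies coordinatewise
between `0` and `rel y₀ y` (`y₀ = Bᵏx₀`), then `y₀ + z ∈ □_k`.  Witness per coordinate: `y₀ + z` itself where `|z_μ| ≤ ρ`, the ball witness of `y` elsewhere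
(its label is that of `y`, and `z_μ` lies between the witness's offset and `rel y₀ y μ`, §1). [cite: Balaban1985Variational, (144) p.300; Balaban1984PropagatorsII, (2.1) p.224] -/
theorem transl_mem_cubeFinM_top_of_between (hM : 1 ≤ M) (hN : 2 * (ρ + M) ≤ P.sitesPerDir k) {y : Site P k}
    (hy : y ∈ cubeFinM x₀ k ρ S M k) {z : LSite P.d}
    (hz : ∀ μ, min 0 (rel (iterBlockOf k x₀) y μ) ≤ z μ ∧ z μ ≤ max 0 (rel (iterBlockOf k x₀) y μ)) :
    transl (iterBlockOf k x₀) z ∈ cubeFinM x₀ k ρ S M k := by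
  classical
  have hr := natAbs_rel_le_of_mem_top hM hy
  rw [mem_cubeFinM_iff] at hy ⊢
  obtain ⟨v, hlab, hdist⟩ := hy
  rw [Nat.sub_self] at hdist ⊢
  have hdist' : ∀ μ, ((v μ - (iterBlockOf k x₀) μ).valMinAbs).natAbs ≤ radM P.L M ρ S 0 :=
    natAbs_valMinAbs_le_of_distSite_le hdist
  have hρ : radM P.L M ρ S 0 = ρ := rfl
  rw [hρ] at hdist'
  have hyμ : ∀ μ, y μ = (iterBlockOf k x₀) μ + ((rel (iterBlockOf k x₀) y μ : ℤ) : ZMod (P.sitesPerDir k)) := fun μ => by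
    have h := congrFun (transl_rel (iterBlockOf k x₀) y) μ
    rw [transl_apply] at h
    exact h.symm
  refine ⟨fun μ => if (z μ).natAbs ≤ ρ then (iterBlockOf k x₀) μ + ((z μ : ℤ) : ZMod (P.sitesPerDir k)) else v μ, fun μ => ?_, ?_⟩
  · -- big-block labels
    rw [transl_apply]
    dsimp only
    split_ifs with hzμ
    · rfl
    · have hs := hdist' μ
      have hv : v μ = (iterBlockOf k x₀) μ + (((v μ - (iterBlockOf k x₀) μ).valMinAbs : ℤ) : ZMod (P.sitesPerDir k)) := by
        rw [ZMod.coe_valMinAbs]; ring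
      have hlabμ := hlab μ
      rw [hv, hyμ μ] at hlabμ
      rw [hv]
      generalize (v μ - (iterBlockOf k x₀) μ).valMinAbs = s at hs hlabμ ⊢
      obtain ⟨hz1, hz2⟩ := hz μ
      have hrμ := hr μ
      rcases le_or_gt 0 (rel (iterBlockOf k x₀) y μ) with hpos | hneg
      · rw [min_eq_left hpos] at hz1
        rw [max_eq_right hpos] at hz2
        rw [val_div_eq_of_between hM ((iterBlockOf k x₀) μ) (u := s) (t := z μ) (by omega) hz2 (by omega) hlabμ, ← hlabμ]
      · rw [min_eq_right hneg.le] at hz1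
        rw [max_eq_left hneg.le] at hz2
        rw [val_div_eq_of_between hM ((iterBlockOf k x₀) μ) (u := rel (iterBlockOf k x₀) y μ) (t := z μ) (w := s) hz1 (by omega)
          (by omega) hlabμ.symm]
  · -- the witness lies in the `ρ`-ball
    rw [hρ]
    unfold distSite
    have key : (Finset.univ.sup fun μ : Fin P.d =>
        (((if (z μ).natAbs ≤ ρ then (iterBlockOf k x₀) μ + ((z μ : ℤ) : ZMod (P.sitesPerDir k)) else v μ) -
          (iterBlockOf k x₀) μ).valMinAbs).natAbs) ≤ ρ := by
      refine Finset.sup_le fun μ _ => ?_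
      split_ifs with hzμ
      · rw [add_sub_cancel_left]
        exact (natAbs_valMinAbs_intCast_le' _).trans hzμ
      · exact hdist' μ
    exact_mod_cast key

end Between

/-! ## §3 The comb, the reversed comb and the contour of a top bond stay in the top cube -/

section Walks

variable {P : Params} {x₀ : Site P 0} {k ρ S M : ℕ}

/-- the end of the walk spelled by `w` from `y` is `y + disp w`. [cite: Balaban1984PropagatorsI, (1.7) p.18, bookkeeping] -/
theorem walkEnd_eq_transl_disp {j : ℕ} (y : Site P j) (w : List (B7Prop1Explicit.Letter P.d)) : walkEnd y w = transl y (disp w) := by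
  funext ν
  rw [walkEnd_apply, transl_apply, disp_apply_eq_netDisp]

/-- every prefix position of the comb `Γ_{y₀,y}` (`y ∈ □_k`) lies in `□_k`. [cite: Balaban1985Averaging, pp.24–25; Balaban1984PropagatorsI, (1.7) p.18] -/
theorem walkEnd_take_treeWord_mem_top (hM : 1 ≤ M) (hN : 2 * (ρ + M) ≤ P.sitesPerDir k) {y : Site P k}
    (hy : y ∈ cubeFinM x₀ k ρ S M k) (i : ℕ) :
    walkEnd (iterBlockOf k x₀) ((treeWord (rel (iterBlockOf k x₀) y)).take i) ∈ cubeFinM x₀ k ρ S M k := by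
  rw [walkEnd_eq_transl_disp]
  exact transl_mem_cubeFinM_top_of_between hM hN hy fun μ =>
    disp_prefix_treeWord_mem _ (List.take_append_drop i (treeWord (rel (iterBlockOf k x₀) y))).symm μ

/-- ★★ **THE COMB `Γ_{y₀,y}` STAYS IN THE TOP CUBE**: for `y ∈ □_k` every step of `walk y₀ (treeWord (rel y₀ y))` has both bond ends in `□_k`
(`1 ≤ M`, `2·(ρ + M) ≤ sitesPerDir k`). [cite: Balaban1985Averaging, pp.24–25 («Γ_{y,x}»); Balaban1985Variational, (144) p.300] -/
theorem walk_treeWord_subset_top (hM : 1 ≤ M) (hN : 2 * (ρ + M) ≤ P.sitesPerDir k) {y : Site P k} (hy : y ∈ cubeFinM x₀ k ρ S M k) :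
    ∀ st ∈ walk (iterBlockOf k x₀) (treeWord (rel (iterBlockOf k x₀) y)),
      st.bond.src ∈ cubeFinM x₀ k ρ S M k ∧ st.bond.tgt ∈ cubeFinM x₀ k ρ S M k := by
  intro st hst
  have h := walk_bond_mem_of_prefix_mem (↑(cubeFinM x₀ k ρ S M k) : Set (Site P k)) _ _
    (fun i _ => Finset.mem_coe.2 (walkEnd_take_treeWord_mem_top hM hN hy i)) st hst
  exact ⟨Finset.mem_coe.1 h.1, Finset.mem_coe.1 h.2⟩

/-- every prefix position of the REVERSED comb from `y ∈ □_k` back to `y₀` lies in `□_k` (it is a prefix position of the comb itself).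
[cite: Balaban1985Averaging, pp.24–25; Balaban1984PropagatorsI, (1.7) p.18] -/
theorem walkEnd_take_revWord_treeWord_mem_top (hM : 1 ≤ M) (hN : 2 * (ρ + M) ≤ P.sitesPerDir k) {y : Site P k}
    (hy : y ∈ cubeFinM x₀ k ρ S M k) (i : ℕ) :
    walkEnd y ((revWord (treeWord (rel (iterBlockOf k x₀) y))).take i) ∈ cubeFinM x₀ k ρ S M k := by
  set W := treeWord (rel (iterBlockOf k x₀) y) with hW
  have hm : (revWord W).take i = revWord (W.drop (W.length - i)) := by
    simp only [revWord, List.take_reverse, List.length_map, List.map_drop]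
  rw [hm, walkEnd_eq_transl_disp, disp_revWord]
  have hyW : y = transl (iterBlockOf k x₀) (disp W) := (transl_disp_treeWord_rel (iterBlockOf k x₀) y).symm
  have hpos : transl y (-disp (W.drop (W.length - i))) = transl (iterBlockOf k x₀) (disp (W.take (W.length - i))) := by
    rw [hyW, ← transl_add]
    congr 1
    have h := disp_append (W.take (W.length - i)) (W.drop (W.length - i))
    rw [List.take_append_drop] at h
    rw [h]
    abel
  rw [hpos]
  exact transl_mem_cubeFinM_top_of_between hM hN hy fun μ =>
    disp_prefix_treeWord_mem _ (List.take_append_drop (W.length - i) W).symm μ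

/-- ★ **THE REVERSED COMB STAYS IN THE TOP CUBE**: for `y ∈ □_k` every step of `walk y (revWord (treeWord (rel y₀ y)))` has both bond ends in `□_k`.
[cite: Balaban1985Averaging, pp.24–25; Balaban1985Variational, (144) p.300] -/
theorem walk_revWord_treeWord_subset_top (hM : 1 ≤ M) (hN : 2 * (ρ + M) ≤ P.sitesPerDir k) {y : Site P k}
    (hy : y ∈ cubeFinM x₀ k ρ S M k) :
    ∀ st ∈ walk y (revWord (treeWord (rel (iterBlockOf k x₀) y))),
      st.bond.src ∈ cubeFinM x₀ k ρ S M k ∧ st.bond.tgt ∈ cubeFinM x₀ k ρ S M k := by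
  intro st hst
  have h := walk_bond_mem_of_prefix_mem (↑(cubeFinM x₀ k ρ S M k) : Set (Site P k)) _ _
    (fun i _ => Finset.mem_coe.2 (walkEnd_take_revWord_treeWord_mem_top hM hN hy i)) st hst
  exact ⟨Finset.mem_coe.1 h.1, Finset.mem_coe.1 h.2⟩

/-- ★★ **THE CONTOUR OF A TOP BOND STAYS IN THE TOP CUBE**: for a top bond `c` with `c₋, c₊ ∈ □_k` every step of `walk y₀ (contourT y₀ c)`
(`Γ_{y₀,c₋} ++ [c] ++ Γ_{y₀,c₊}⁻¹`, ✓`contourT_eq`; no wrap ✓`rel_shift_of_le`) has both bond ends in `□_k` (`1 ≤ M`, `2·(ρ + M) ≤ sitesPerDir k`).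
[cite: Balaban1985UV3, (27) p.263; Balaban1985Averaging, pp.24–25; Balaban1985Variational, (144) p.300] -/
theorem walk_contourT_subset_top (hM : 1 ≤ M) (hN : 2 * (ρ + M) ≤ P.sitesPerDir k) {c : PBond P k}
    (hsrc : c.src ∈ cubeFinM x₀ k ρ S M k) (htgt : c.tgt ∈ cubeFinM x₀ k ρ S M k) :
    ∀ st ∈ walk (iterBlockOf k x₀) (contourT (iterBlockOf k x₀) c),
      st.bond.src ∈ cubeFinM x₀ k ρ S M k ∧ st.bond.tgt ∈ cubeFinM x₀ k ρ S M k := by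
  have hwrap : (rel (iterBlockOf k x₀) c.src c.dir + 1) * 2 ≤ (P.sitesPerDir k : ℤ) := by
    have h := natAbs_rel_le_of_mem_top hM hsrc c.dir
    omega
  have hrel : rel (iterBlockOf k x₀) c.src + e c.dir = rel (iterBlockOf k x₀) c.tgt :=
    (rel_shift_of_le (iterBlockOf k x₀) c.src c.dir hwrap).symm
  rw [contourT_eq, hrel, walk_append, walk_append, walkEnd_append, walkEnd_treeWord_rel]
  intro st hst
  rcases List.mem_append.1 hst with hst | hst
  · rcases List.mem_append.1 hst with hst | hst
    · exact walk_treeWord_subset_top hM hN hsrc st hst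
    · simp only [walk, List.mem_singleton] at hst
      subst hst
      exact ⟨hsrc, htgt⟩
  · have hend : walkEnd c.src [(c.dir, true)] = c.tgt := rfl
    rw [hend] at hst
    exact walk_revWord_treeWord_subset_top hM hN htgt st hst

end Walks

/-! ## §4 The member's top level `Ω_{K−n}` under the room premise `ρ + M ≤ L^{m+n}` -/

section Member

variable (F : T3Family) (n K : ℕ)

/-- the room premise of record gives the no-wrap premise at the member's top level: `2·(ρ + M) ≤ sitesPerDir (K−n) = 2·L^{m+n}`.
[cite: Balaban1985Variational, (144) p.300; Balaban1984PropagatorsI, (1.18) p.20] -/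
theorem two_mul_add_le_sitesPerDir_top_of_room (hnK : n ≤ K) {ρ M : ℕ} (hroom : ρ + M ≤ F.L ^ (F.m + n)) :
    2 * (ρ + M) ≤ (F.P K).sitesPerDir (K - n) := by
  show 2 * (ρ + M) ≤ 2 * F.L ^ (F.m + K - (K - n))
  rw [show F.m + K - (K - n) = F.m + n by omega]
  omega

/-- ★★ **THE COMB STAYS IN `Ω_{K−n}`** of `cubeSeqMT3 F n K x ρ S M hM` (`n < K`, `1 ≤ M`, room `ρ + M ≤ L^{m+n}`): for `y ∈ Ω_{K−n}` every step of
`walk y₀ (treeWord (rel y₀ y))`, `y₀ = B^{K−n}x`, has both bond ends in `Ω_{K−n}` — the `h`-territory of ✓`P1FlatCoreDP1Target.norm_axialT_sub_one_le`.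
[cite: Balaban1985Averaging, pp.24–25; Balaban1985Variational, (144) p.300] -/
theorem walk_treeWord_subset_Om_top (hnK : n < K) (x : Site (F.P K) 0) (ρ S M : ℕ) (hM : 1 ≤ M) (hroom : ρ + M ≤ F.L ^ (F.m + n))
    {y : Site (F.P K) (K - n)} (hy : y ∈ (cubeSeqMT3 F n K x ρ S M hM).Om (K - n)) :
    ∀ st ∈ walk (iterBlockOf (K - n) x) (treeWord (rel (iterBlockOf (K - n) x) y)),
      st.bond.src ∈ (cubeSeqMT3 F n K x ρ S M hM).Om (K - n) ∧ st.bond.tgt ∈ (cubeSeqMT3 F n K x ρ S M hM).Om (K - n) := by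
  rw [show (cubeSeqMT3 F n K x ρ S M hM).Om (K - n) = cubeFinM x (K - n) ρ S M (K - n) from
    cubeSeqM_Om_pos x (FlatMinimizerH.le_T3 F n K) ρ S M hM (by omega) le_rfl] at hy ⊢
  exact walk_treeWord_subset_top hM (two_mul_add_le_sitesPerDir_top_of_room F n K hnK.le hroom) hy

/-- ★★ **THE CONTOUR OF A TOP BOND STAYS IN `Ω_{K−n}`** (`n < K`, `1 ≤ M`, room `ρ + M ≤ L^{m+n}`, `c₋, c₊ ∈ Ω_{K−n}`).
[cite: Balaban1985UV3, (27) p.263; Balaban1985Averaging, pp.24–25; Balaban1985Variational, (144) p.300] -/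
theorem walk_contourT_subset_Om_top (hnK : n < K) (x : Site (F.P K) 0) (ρ S M : ℕ) (hM : 1 ≤ M) (hroom : ρ + M ≤ F.L ^ (F.m + n))
    {c : PBond (F.P K) (K - n)} (hsrc : c.src ∈ (cubeSeqMT3 F n K x ρ S M hM).Om (K - n))
    (htgt : c.tgt ∈ (cubeSeqMT3 F n K x ρ S M hM).Om (K - n)) :
    ∀ st ∈ walk (iterBlockOf (K - n) x) (contourT (iterBlockOf (K - n) x) c),
      st.bond.src ∈ (cubeSeqMT3 F n K x ρ S M hM).Om (K - n) ∧ st.bond.tgt ∈ (cubeSeqMT3 F n K x ρ S M hM).Om (K - n) := by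
  rw [show (cubeSeqMT3 F n K x ρ S M hM).Om (K - n) = cubeFinM x (K - n) ρ S M (K - n) from
    cubeSeqM_Om_pos x (FlatMinimizerH.le_T3 F n K) ρ S M hM (by omega) le_rfl] at hsrc htgt ⊢
  exact walk_contourT_subset_top hM (two_mul_add_le_sitesPerDir_top_of_room F n K hnK.le hroom) hsrc htgt

end Member

end Summit.QuantumFields.YangMills.Theorems.P1FlatCoreTopCubeWalks
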